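import Mathlib
import Summits.ResolutionOfSingularities.ResolutionOfSingularities.Theorems.HomologicalConductorPersistenceConductorStable
import HarnessLib

/-!
# Crux `Persistence` (stmt-ResolutionOfSingularities-16484) / rung S-2 — the COPRIME MONOMIAL CUSP `zᵐ − εᵐ tⁿ`:
# `k[z,t]/(zᵐ − εᵐtⁿ) ↪ k[τ]` (`z ↦ ετⁿ`, `t ↦ τᵐ`), image `⊇ τ^{(m−1)(n−1)} k[τ]`, conductor `⊆ ca²` — fact-free

Route `ResolutionOfSingularities/HomologicalConductor`, chain W4.4b (cell `res-hironaka`): crux `Persistence`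
(stmt-ResolutionOfSingularities-16484; the `E₆` instance `(m,n,ε) = (3,4,−1)` is the curve stage of K-C3) and rung S-2
`PersistenceSurface` (stmt-…-19970: double points `x² = zᵐ + tⁿ` — `A_{2j}` `(m,n,ε) = (2j+1, 2, −1)`, `E₆ (3,4,−1)`,
`E₈ (3,5,−1)`, the `W/Z`-type Brieskorn curves — via `…PersistenceArenaLowerMiddle`'s fact-free `(x) + ca²(C_g) ⊆ ca³({x² = g})`).
`[OURS · L1 w44b · res-L1-w44b-stub-2 gen 4]`; NOT a statement of the manuscript under review (Hironaka 2017), no statement of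
that manuscript is used; AI-written, weaker than expert review.  Generalises `…PersistenceKC3LowerCurve` §1–§2 (p533826).

Data: a field `k`, `ε : k` with `ε ≠ 0`, coprime `m, n`; `h = X 0 ^ m − C (ε ^ m) * X 1 ^ n ∈ k[z,t] = MvPolynomial (Fin 2) k`
(`z = X 0`, `t = X 1`); the parametrisation `θ = aeval ![C ε * τⁿ, τᵐ] : k[z,t] → k[τ]` (so `θ h = 0`).

* §1 `θ` on generators, `θ h = 0`, `θ (r(t)) = expandₘ r`.
* §2 NORMAL FORM `g ≡ Σ_{i<m} rᵢ(t) zⁱ (mod h)` (`exists_normalForm`, induction on `g`; `zᵐ ≡ εᵐ tⁿ`).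
* §3 KERNEL `θ g = 0 ⇒ g ∈ (h)` (`mem_span_of_param_eq_zero`): the coefficient of `τ^{mM + n i₀}` in
  `Σᵢ εⁱ expandₘ(rᵢ) τ^{ni}` is `ε^{i₀} (r_{i₀})_M`, because `m ∣ n(i₀ − i)` with `|i₀ − i| < m` forces `i = i₀` (coprimality).
* §4 IMAGE `τ^{(m−1)(n−1)} k[τ] ⊆ θ(k[z,t])` (`exists_param_eq_X_pow_mul`, Mathlib's `frobeniusNumber_pair`; `1 < m, n`).
* §5 CONDUCTOR ⊆ `ca²`: **`mem_cohomologyAnnihilatorOfDegree_two_of_X_pow_dvd`**: if `τ^{(m−1)(n−1)} ∣ θ c` then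
  `c̄ ∈ ca²(k[z,t]/(h))` (`…PersistenceConductorStable`, p532769); in particular every monomial `zᵃtᵇ` with
  `na + mb ≥ (m−1)(n−1)` (`mk_monomial_mem_cohomologyAnnihilatorOfDegree_two`).

References (mechanism only): Ö. Esentepe, J. Algebra 541 (2020) Thm 4.4 (`ca = 𝔠` for reduced Gorenstein curves; here the
`⊆ ca` half for monomial cusps, elementary) [`Esentepe2020`]; J. J. Sylvester 1882 (Frobenius number of two coins, Mathlib
`frobeniusNumber_pair`).
-/

noncomputable section

-- single-problem summit: the doubled namespace component `ResolutionOfSingularities` is forced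
set_option linter.dupNamespace false

namespace Summit.ResolutionOfSingularities.ResolutionOfSingularities.Theorems.HomologicalConductor.MonomialCusp

open MvPolynomial Literature.RingTheory.CohomologyAnnihilator
open Summit.ResolutionOfSingularities.ResolutionOfSingularities.Theorems.HomologicalConductor.ConductorStable

universe u

variable (k : Type u) [Field k] (ε : k) (m n : ℕ)

/-! ## §1 The parametrisation on generators -/

/-- `θ z = ε τⁿ`. [folklore] -/
theorem param_X_zero :
    (MvPolynomial.aeval (R := k) (![Polynomial.C ε * Polynomial.X ^ n, Polynomial.X ^ m] : Fin 2 → Polynomial k))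
      (X 0 : MvPolynomial (Fin 2) k) = Polynomial.C ε * Polynomial.X ^ n := by
  simp

/-- `θ t = τᵐ`. [folklore] -/
theorem param_X_one :
    (MvPolynomial.aeval (R := k) (![Polynomial.C ε * Polynomial.X ^ n, Polynomial.X ^ m] : Fin 2 → Polynomial k))
      (X 1 : MvPolynomial (Fin 2) k) = Polynomial.X ^ m := by
  simp

/-- `θ (zᵐ − εᵐ tⁿ) = 0`. [folklore] -/
theorem param_h :
    (MvPolynomial.aeval (R := k) (![Polynomial.C ε * Polynomial.X ^ n, Polynomial.X ^ m] : Fin 2 → Polynomial k))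
      (X 0 ^ m - C (ε ^ m) * X 1 ^ n : MvPolynomial (Fin 2) k) = 0 := by
  simp only [map_sub, map_mul, map_pow, param_X_zero, param_X_one, MvPolynomial.algHom_C, Polynomial.algebraMap_eq,
    mul_pow, ← pow_mul, mul_comm n m, sub_self]

/-- `θ` kills the ideal `(h)`. [folklore] -/
theorem param_eq_zero_of_mem_span {u : MvPolynomial (Fin 2) k}
    (hu : u ∈ Ideal.span ({X 0 ^ m - C (ε ^ m) * X 1 ^ n} : Set (MvPolynomial (Fin 2) k))) :
    (MvPolynomial.aeval (R := k) (![Polynomial.C ε * Polynomial.X ^ n, Polynomial.X ^ m] : Fin 2 → Polynomial k)) u = 0 := by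
  obtain ⟨v, rfl⟩ := Ideal.mem_span_singleton'.mp hu
  rw [map_mul, param_h, mul_zero]

/-- `θ(r(t)) = expandₘ r`. [folklore] -/
theorem param_aeval_X_one (r : Polynomial k) :
    (MvPolynomial.aeval (R := k) (![Polynomial.C ε * Polynomial.X ^ n, Polynomial.X ^ m] : Fin 2 → Polynomial k))
        (Polynomial.aeval (X 1 : MvPolynomial (Fin 2) k) r) = Polynomial.expand k m r := by
  have hc : ((MvPolynomial.aeval (R := k) (![Polynomial.C ε * Polynomial.X ^ n, Polynomial.X ^ m] :
      Fin 2 → Polynomial k)).comp (Polynomial.aeval (X 1 : MvPolynomial (Fin 2) k))) = Polynomial.expand k m := by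
    refine Polynomial.algHom_ext ?_
    simp [Polynomial.expand_X]
  exact congrArg (fun φ : Polynomial k →ₐ[k] Polynomial k => φ r) hc

/-! ## §2 Normal form modulo `zᵐ − εᵐ tⁿ` -/

/-- **Normal form**: every `g ∈ k[z,t]` is `≡ Σ_{i<m} rᵢ(t) zⁱ (mod zᵐ − εᵐtⁿ)` (`m ≥ 1`), `rᵢ ∈ k[T]`. [folklore] -/
theorem exists_normalForm (m' : ℕ) (g : MvPolynomial (Fin 2) k) :
    ∃ r : ℕ → Polynomial k,
      g - ∑ i ∈ Finset.range (m' + 1), Polynomial.aeval (X 1 : MvPolynomial (Fin 2) k) (r i) * X 0 ^ i ∈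
        Ideal.span ({X 0 ^ (m' + 1) - C (ε ^ (m' + 1)) * X 1 ^ n} : Set (MvPolynomial (Fin 2) k)) := by
  induction g using MvPolynomial.induction_on with
  | C a =>
    refine ⟨fun i => if i = 0 then Polynomial.C a else 0, ?_⟩
    rw [Finset.sum_range_succ']
    simp
  | add p q hp hq =>
    obtain ⟨rp, hp⟩ := hp
    obtain ⟨rq, hq⟩ := hq
    refine ⟨fun i => rp i + rq i, ?_⟩
    have : p + q - ∑ i ∈ Finset.range (m' + 1), Polynomial.aeval (X 1 : MvPolynomial (Fin 2) k) (rp i + rq i) * X 0 ^ i =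
        (p - ∑ i ∈ Finset.range (m' + 1), Polynomial.aeval (X 1 : MvPolynomial (Fin 2) k) (rp i) * X 0 ^ i) +
        (q - ∑ i ∈ Finset.range (m' + 1), Polynomial.aeval (X 1 : MvPolynomial (Fin 2) k) (rq i) * X 0 ^ i) := by
      simp only [map_add, add_mul, Finset.sum_add_distrib]
      ring
    rw [this]
    exact Ideal.add_mem _ hp hq
  | mul_X p i hp =>
    obtain ⟨r, hr⟩ := hp
    have hi : i = 0 ∨ i = 1 := by fin_cases i <;> simp
    rcases hi with rfl | rfl
    · -- multiplication by `z`: shift, and reduce `zᵐ ≡ εᵐ tⁿ`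
      refine ⟨fun j => if j = 0 then Polynomial.C (ε ^ (m' + 1)) * Polynomial.X ^ n * r m' else r (j - 1), ?_⟩
      have hshift : ∑ j ∈ Finset.range (m' + 1), Polynomial.aeval (X 1 : MvPolynomial (Fin 2) k)
            ((fun j => if j = 0 then Polynomial.C (ε ^ (m' + 1)) * Polynomial.X ^ n * r m' else r (j - 1)) j) * X 0 ^ j =
          ∑ j ∈ Finset.range m', Polynomial.aeval (X 1 : MvPolynomial (Fin 2) k) (r j) * X 0 ^ (j + 1) +
            C (ε ^ (m' + 1)) * X 1 ^ n * Polynomial.aeval (X 1 : MvPolynomial (Fin 2) k) (r m') := by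
        rw [Finset.sum_range_succ']
        simp only [Nat.succ_ne_zero, if_false, Nat.add_sub_cancel, if_true, pow_zero, mul_one, map_mul, map_pow,
          Polynomial.aeval_C, Polynomial.aeval_X, MvPolynomial.algebraMap_eq]
      have hold : (∑ j ∈ Finset.range (m' + 1), Polynomial.aeval (X 1 : MvPolynomial (Fin 2) k) (r j) * X 0 ^ j) * X 0 =
          ∑ j ∈ Finset.range m', Polynomial.aeval (X 1 : MvPolynomial (Fin 2) k) (r j) * X 0 ^ (j + 1) +
            Polynomial.aeval (X 1 : MvPolynomial (Fin 2) k) (r m') * X 0 ^ (m' + 1) := by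
        rw [Finset.sum_range_succ, add_mul, Finset.sum_mul]
        congr 1
        · exact Finset.sum_congr rfl fun j _ => by ring
        · ring
      have hid : p * X 0 - ∑ j ∈ Finset.range (m' + 1), Polynomial.aeval (X 1 : MvPolynomial (Fin 2) k)
            ((fun j => if j = 0 then Polynomial.C (ε ^ (m' + 1)) * Polynomial.X ^ n * r m' else r (j - 1)) j) * X 0 ^ j =
          (p - ∑ j ∈ Finset.range (m' + 1), Polynomial.aeval (X 1 : MvPolynomial (Fin 2) k) (r j) * X 0 ^ j) * X 0 +
            Polynomial.aeval (X 1 : MvPolynomial (Fin 2) k) (r m') * (X 0 ^ (m' + 1) - C (ε ^ (m' + 1)) * X 1 ^ n) := by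
        rw [hshift, sub_mul, hold]
        ring
      rw [hid]
      exact Ideal.add_mem _ (Ideal.mul_mem_right _ _ hr) (Ideal.mul_mem_left _ _ (Ideal.subset_span (Set.mem_singleton _)))
    · -- multiplication by `t`
      refine ⟨fun j => r j * Polynomial.X, ?_⟩
      have hid : p * X 1 - ∑ j ∈ Finset.range (m' + 1), Polynomial.aeval (X 1 : MvPolynomial (Fin 2) k)
            (r j * Polynomial.X) * X 0 ^ j =
          (p - ∑ j ∈ Finset.range (m' + 1), Polynomial.aeval (X 1 : MvPolynomial (Fin 2) k) (r j) * X 0 ^ j) * X 1 := by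
        simp only [map_mul, Polynomial.aeval_X, Finset.sum_mul, sub_mul]
        refine congrArg₂ _ rfl (Finset.sum_congr rfl fun j _ => ?_)
        ring
      rw [hid]
      exact Ideal.mul_mem_right _ _ hr

/-! ## §3 The kernel of the parametrisation -/

/-- Exponent arithmetic: for coprime `m, n` and `i, i₀ < m`, `m ∣ mM + n i₀ − n i` (with `n i ≤ mM + n i₀`) forces
`i = i₀`. [folklore] -/
theorem eq_of_dvd_sub (hmn : Nat.Coprime m n) {M i i₀ : ℕ} (hi : i < m) (hi₀ : i₀ < m)
    (hle : n * i ≤ m * M + n * i₀) (hdvd : m ∣ m * M + n * i₀ - n * i) : i = i₀ := by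
  have h1 : (m : ℤ) ∣ ((m * M + n * i₀ - n * i : ℕ) : ℤ) := Int.natCast_dvd_natCast.mpr hdvd
  rw [Nat.cast_sub hle] at h1
  push_cast at h1
  have h2 : (m : ℤ) ∣ (n : ℤ) * ((i₀ : ℤ) - i) := by
    have h3 := dvd_sub h1 (dvd_mul_right (m : ℤ) (M : ℤ))
    have e : ((m : ℤ) * M + n * i₀ - n * i) - m * M = (n : ℤ) * ((i₀ : ℤ) - i) := by ring
    rwa [e] at h3
  have hcop : IsCoprime (m : ℤ) (n : ℤ) := Nat.isCoprime_iff_coprime.mpr hmn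
  have h4 : (m : ℤ) ∣ (i₀ : ℤ) - i := hcop.dvd_of_dvd_mul_left h2
  have h5 : ((i₀ : ℤ) - i) = 0 := Int.eq_zero_of_abs_lt_dvd h4 (by rw [abs_lt]; constructor <;> omega)
  omega

/-- The coefficient of `τ^{mM + n i₀}` in `Σ_{i<m} εⁱ expandₘ(rᵢ) τ^{ni}` is `ε^{i₀} (r_{i₀})_M` (`m ≥ 1`, `gcd(m,n) = 1`).
[folklore] -/
theorem coeff_sum_expand (hmn : Nat.Coprime m n) (hm : 0 < m) (r : ℕ → Polynomial k) (M : ℕ) {i₀ : ℕ} (hi₀ : i₀ < m) :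
    (∑ i ∈ Finset.range m, Polynomial.expand k m (r i) * (Polynomial.C ε * Polynomial.X ^ n) ^ i).coeff
        (m * M + n * i₀) = ε ^ i₀ * (r i₀).coeff M := by
  have hterm : ∀ i ∈ Finset.range m, (Polynomial.expand k m (r i) * (Polynomial.C ε * Polynomial.X ^ n) ^ i).coeff
      (m * M + n * i₀) = if i = i₀ then ε ^ i₀ * (r i₀).coeff M else 0 := by
    intro i hi
    rw [Finset.mem_range] at hi
    rw [mul_pow, ← pow_mul, ← Polynomial.C_pow, mul_left_comm, Polynomial.coeff_C_mul, Polynomial.coeff_mul_X_pow',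
      Polynomial.coeff_expand hm]
    by_cases hii : i = i₀
    · subst hii
      rw [if_pos (by omega), if_pos rfl, show m * M + n * i - n * i = m * M by omega, if_pos (dvd_mul_right m M),
        Nat.mul_div_cancel_left M hm]
    · rw [if_neg hii]
      split_ifs with h1 h2
      · exact absurd (eq_of_dvd_sub m n hmn hi hi₀ h1 h2) hii
      · rw [mul_zero]
      · rw [mul_zero]
  rw [Polynomial.finsetSum_coeff, Finset.sum_congr rfl hterm, Finset.sum_ite_eq' (Finset.range m) i₀,
    if_pos (Finset.mem_range.mpr hi₀)]

/-- **KERNEL LEMMA**: for `ε ≠ 0`, coprime `m, n ≥ 1`: if `g(ετⁿ, τᵐ) = 0` then `g ∈ (zᵐ − εᵐ tⁿ)` — i.e.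
`k[z,t]/(zᵐ − εᵐtⁿ) → k[τ]` is injective. [folklore] -/
theorem mem_span_of_param_eq_zero (hε : ε ≠ 0) (hmn : Nat.Coprime m n) (hm : 0 < m) (g : MvPolynomial (Fin 2) k)
    (hg : (MvPolynomial.aeval (R := k) (![Polynomial.C ε * Polynomial.X ^ n, Polynomial.X ^ m] : Fin 2 → Polynomial k))
      g = 0) :
    g ∈ Ideal.span ({X 0 ^ m - C (ε ^ m) * X 1 ^ n} : Set (MvPolynomial (Fin 2) k)) := by
  obtain ⟨m', rfl⟩ : ∃ m', m = m' + 1 := ⟨m - 1, by omega⟩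
  obtain ⟨r, hr⟩ := exists_normalForm k ε n m' g
  have hE : (∑ i ∈ Finset.range (m' + 1), Polynomial.expand k (m' + 1) (r i) *
      (Polynomial.C ε * Polynomial.X ^ n) ^ i) = 0 := by
    have h0 := param_eq_zero_of_mem_span k ε (m' + 1) n hr
    rw [map_sub, hg, zero_sub, neg_eq_zero, map_sum] at h0
    simpa only [map_mul, map_pow, param_aeval_X_one, param_X_zero] using h0
  have hr0 : ∀ i ∈ Finset.range (m' + 1), r i = 0 := fun i₀ hi₀ => Polynomial.ext fun M => by
    have h := coeff_sum_expand k ε (m' + 1) n hmn (Nat.succ_pos _) r M (Finset.mem_range.mp hi₀)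
    rw [hE, Polynomial.coeff_zero] at h
    have h1 : ε ^ i₀ ≠ 0 := pow_ne_zero _ hε
    simpa [h1] using h.symm
  have hsum : ∑ i ∈ Finset.range (m' + 1), Polynomial.aeval (X 1 : MvPolynomial (Fin 2) k) (r i) * X 0 ^ i = 0 :=
    Finset.sum_eq_zero fun i hi => by rw [hr0 i hi, map_zero, zero_mul]
  simpa [hsum] using hr

/-! ## §4 The image contains `τ^{(m−1)(n−1)} · k[τ]` -/

/-- Every `N ≥ (m−1)(n−1)` is `a m + b n` (`m, n > 1` coprime; Sylvester / Mathlib `frobeniusNumber_pair`). [folklore] -/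
theorem exists_mul_add_mul (hmn : Nat.Coprime m n) (hm : 1 < m) (hn : 1 < n) (N : ℕ) :
    ∃ a b : ℕ, a * m + b * n = N + (m - 1) * (n - 1) := by
  have key : m * n - m - n < N + (m - 1) * (n - 1) := by
    obtain ⟨m'', rfl⟩ : ∃ m'', m = m'' + 2 := ⟨m - 2, by omega⟩
    obtain ⟨n'', rfl⟩ : ∃ n'', n = n'' + 2 := ⟨n - 2, by omega⟩
    have e1 : (m'' + 2) * (n'' + 2) - (m'' + 2) - (n'' + 2) = m'' * n'' + m'' + n'' := by
      rw [Nat.sub_sub]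
      apply Nat.sub_eq_of_eq_add
      ring
    have e2 : (m'' + 2 - 1) * (n'' + 2 - 1) = m'' * n'' + m'' + n'' + 1 := by
      rw [show m'' + 2 - 1 = m'' + 1 by omega, show n'' + 2 - 1 = n'' + 1 by omega]
      ring
    rw [e1, e2]
    omega
  have hF := (frobeniusNumber_iff.mp (frobeniusNumber_pair hmn hm hn)).2 (N + (m - 1) * (n - 1)) key
  obtain ⟨a, b, hab⟩ := (AddSubmonoid.mem_closure_pair m n _).mp hF
  exact ⟨a, b, by simpa [smul_eq_mul] using hab⟩

/-- **IMAGE LEMMA**: `τ^{(m−1)(n−1)} · d ∈ θ(k[z,t])` for every `d ∈ k[τ]` (`ε ≠ 0`, `m, n > 1` coprime):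
`τ^{am+bn} = ε^{−b} θ(tᵃ zᵇ)`. [folklore] -/
theorem exists_param_eq_X_pow_mul (hε : ε ≠ 0) (hmn : Nat.Coprime m n) (hm : 1 < m) (hn : 1 < n) (d : Polynomial k) :
    ∃ g : MvPolynomial (Fin 2) k,
      (MvPolynomial.aeval (R := k) (![Polynomial.C ε * Polynomial.X ^ n, Polynomial.X ^ m] : Fin 2 → Polynomial k)) g =
        Polynomial.X ^ ((m - 1) * (n - 1)) * d := by
  induction d using Polynomial.induction_on' with
  | add p q hp hq =>
    obtain ⟨gp, hp⟩ := hp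
    obtain ⟨gq, hq⟩ := hq
    exact ⟨gp + gq, by rw [map_add, hp, hq, mul_add]⟩
  | monomial N a =>
    obtain ⟨i, j, hij⟩ := exists_mul_add_mul m n hmn hm hn N
    have aux : ∀ c : k, (MvPolynomial.aeval (R := k) (![Polynomial.C ε * Polynomial.X ^ n, Polynomial.X ^ m] :
        Fin 2 → Polynomial k)) (C c * (X 1 ^ i * X 0 ^ j)) =
        Polynomial.C c * (Polynomial.X ^ (m * i) * (Polynomial.C (ε ^ j) * Polynomial.X ^ (n * j))) := fun c => by
      rw [map_mul, map_mul, map_pow, map_pow, MvPolynomial.algHom_C, Polynomial.algebraMap_eq, param_X_zero,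
        param_X_one, mul_pow, ← Polynomial.C_pow, ← pow_mul, ← pow_mul]
    refine ⟨C (a * (ε ^ j)⁻¹) * (X 1 ^ i * X 0 ^ j), ?_⟩
    rw [aux, ← Polynomial.C_mul_X_pow_eq_monomial]
    have hεj : (ε ^ j)⁻¹ * ε ^ j = 1 := inv_mul_cancel₀ (pow_ne_zero _ hε)
    have hexp : m * i + n * j = (m - 1) * (n - 1) + N := by rw [mul_comm m i, mul_comm n j, hij, add_comm]
    calc Polynomial.C (a * (ε ^ j)⁻¹) * (Polynomial.X ^ (m * i) * (Polynomial.C (ε ^ j) * Polynomial.X ^ (n * j)))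
        = Polynomial.C (a * ((ε ^ j)⁻¹ * ε ^ j)) * Polynomial.X ^ (m * i + n * j) := by
          rw [pow_add, Polynomial.C_mul, Polynomial.C_mul, Polynomial.C_mul]; ring
      _ = Polynomial.X ^ ((m - 1) * (n - 1)) * (Polynomial.C a * Polynomial.X ^ N) := by
          rw [hεj, mul_one, hexp, pow_add]; ring

/-! ## §5 The conductor lies in `ca²` -/

/-- **CONDUCTOR ⊆ `ca²` for the coprime monomial cusp**: `ε ≠ 0`, `m, n > 1` coprime, `c ∈ k[z,t]` with
`τ^{(m−1)(n−1)} ∣ c(ετⁿ, τᵐ)`.  Then `c̄ ∈ ca²(k[z,t]/(zᵐ − εᵐ tⁿ))` — fact-free (`…PersistenceConductorStable`).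
[OURS · L1 w44b] -/
theorem mem_cohomologyAnnihilatorOfDegree_two_of_X_pow_dvd (hε : ε ≠ 0) (hmn : Nat.Coprime m n) (hm : 1 < m)
    (hn : 1 < n) (c : MvPolynomial (Fin 2) k)
    (hc : Polynomial.X ^ ((m - 1) * (n - 1)) ∣
      (MvPolynomial.aeval (R := k) (![Polynomial.C ε * Polynomial.X ^ n, Polynomial.X ^ m] : Fin 2 → Polynomial k)) c) :
    Ideal.Quotient.mk (Ideal.span ({X 0 ^ m - C (ε ^ m) * X 1 ^ n} : Set (MvPolynomial (Fin 2) k))) c ∈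
      cohomologyAnnihilatorOfDegree
        (MvPolynomial (Fin 2) k ⧸ Ideal.span ({X 0 ^ m - C (ε ^ m) * X 1 ^ n} : Set (MvPolynomial (Fin 2) k))) 2 := by
  -- the parametrisation descends to an injective ring map `ψ` on the quotient
  set θ := (MvPolynomial.aeval (R := k) (![Polynomial.C ε * Polynomial.X ^ n, Polynomial.X ^ m] :
    Fin 2 → Polynomial k)).toRingHom with hθ
  have hθ_apply : ∀ g, θ g = (MvPolynomial.aeval (R := k) (![Polynomial.C ε * Polynomial.X ^ n, Polynomial.X ^ m] :
      Fin 2 → Polynomial k)) g := fun g => rfl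
  have hθI : ∀ a ∈ Ideal.span ({X 0 ^ m - C (ε ^ m) * X 1 ^ n} : Set (MvPolynomial (Fin 2) k)), θ a = 0 :=
    fun a ha => param_eq_zero_of_mem_span k ε m n ha
  set ψ := Ideal.Quotient.lift _ θ hθI with hψ
  have hψ_mk : ∀ g, ψ (Ideal.Quotient.mk _ g) = θ g := fun g => Ideal.Quotient.lift_mk _ _ _
  have hinj : Function.Injective ψ := by
    rw [injective_iff_map_eq_zero]
    intro u hu
    obtain ⟨g, rfl⟩ := Ideal.Quotient.mk_surjective u
    rw [hψ_mk, hθ_apply] at hu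
    exact Ideal.Quotient.eq_zero_iff_mem.mpr (mem_span_of_param_eq_zero k ε m n hε hmn (by omega) g hu)
  refine mem_cohomologyAnnihilatorOfDegree_two_of_conductor_ringHom ψ hinj fun d => ?_
  obtain ⟨e, he⟩ := hc
  obtain ⟨g, hg⟩ := exists_param_eq_X_pow_mul k ε m n hε hmn hm hn (e * d)
  refine ⟨Ideal.Quotient.mk _ g, ?_⟩
  rw [hψ_mk, hψ_mk, hθ_apply, hθ_apply, hg, he, mul_assoc]

/-- **Monomials in the conductor**: `zᵇ tᵃ` with `n b + m a ≥ (m−1)(n−1)` lies in `ca²(k[z,t]/(zᵐ − εᵐ tⁿ))`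
(`ε ≠ 0`, `m, n > 1` coprime). [OURS · L1 w44b] -/
theorem mk_monomial_mem_cohomologyAnnihilatorOfDegree_two (hε : ε ≠ 0) (hmn : Nat.Coprime m n) (hm : 1 < m)
    (hn : 1 < n) (a b : ℕ) (hab : (m - 1) * (n - 1) ≤ n * b + m * a) :
    Ideal.Quotient.mk (Ideal.span ({X 0 ^ m - C (ε ^ m) * X 1 ^ n} : Set (MvPolynomial (Fin 2) k))) (X 0 ^ b * X 1 ^ a) ∈
      cohomologyAnnihilatorOfDegree
        (MvPolynomial (Fin 2) k ⧸ Ideal.span ({X 0 ^ m - C (ε ^ m) * X 1 ^ n} : Set (MvPolynomial (Fin 2) k))) 2 := by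
  refine mem_cohomologyAnnihilatorOfDegree_two_of_X_pow_dvd k ε m n hε hmn hm hn _ ?_
  obtain ⟨e, he⟩ : ∃ e, n * b + m * a = (m - 1) * (n - 1) + e :=
    ⟨n * b + m * a - (m - 1) * (n - 1), (Nat.add_sub_cancel' hab).symm⟩
  refine ⟨Polynomial.C (ε ^ b) * Polynomial.X ^ e, ?_⟩
  rw [map_mul, map_pow, map_pow, param_X_zero, param_X_one, mul_pow, ← Polynomial.C_pow, ← pow_mul, ← pow_mul,
    mul_assoc, ← pow_add, he, pow_add]
  ring

end Summit.ResolutionOfSingularities.ResolutionOfSingularities.Theorems.HomologicalConductor.MonomialCusp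

end
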